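import Literature.Computability.Complexity.BPClosureProofs
import Literature.Computability.Complexity.ProbabilisticClassesProofs
import Literature.Computability.Complexity.StringCopy
import Literature.Computability.Complexity.BrickAlgebra
import Literature.Computability.Complexity.ReductionsProofs
import HarnessLib

/-!
# `∃·BPP` (the tree's `polyExists BPP`) is closed under Karp reductions; `coNP ⊆ ∃·BPP` iff the
# complement of one NP-hard language is in `∃·BPP`

Sibling of `BPClosureProofs.lean` (which does this for `BPP` and for `AM = BP·NP`): the class
`polyExists BPP` — the tree's rendering of "`∃BPP`" in the conditional barriers of
Bläser–Ikenmeyer–Jindal–Lysikov 2018 (`BIJL2018_thm4`, `BIJL2018_thm5`, file `BIJL18MatrixCompletion.lean`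
/ `BIJL18PermanentZero.lean`) and Bläser–Ikenmeyer–Lysikov–Pandey–Schreyer 2019 (`BILPS2019_cor42`,
"unless `coNP ⊆ ∃BPP`") — is closed under polynomial-time preimages (Arora–Barak's Exercise 2.9 / Thm. 2.8
pattern for `∃·K`, with `K = BPP` closed under `FP`-preimages and under intersection with `P`
languages), hence downward closed under `≤ₚ`; and therefore **`coNP ⊆ ∃·BPP` as soon as `Lᶜ ∈ ∃·BPP`
for a single NP-hard `L`** — the class-level step of every "… unless `coNP ⊆ ∃BPP`" barrier proof
(BIJL18 Thm 4, BILPS19 Thm 40 / Cor 42: one puts the complement of an NP-hard membership problem in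
`∃·BPP`).

* `inter_mem_BPP_of_mem_P_left` — `K ∈ P`, `L ∈ BPP ⇒ K ⊓ L ∈ BPP` (witness `fst⁻¹ K ⊓ L'`, same coins).
* `preimage_mem_polyExists_BPP`, `mem_polyExists_BPP_of_karpReducible` — `∃·BPP` is closed under
  `FP` preimages / downward under `≤ₚ`.
* `NP_subset_polyExists_BPP` — `NP = ∃·P ⊆ ∃·BPP`.
* `coNP_subset_polyExists_BPP_of_isNPHard_of_compl_mem`, `coNP_subset_polyExists_BPP_iff_compl_mem`.

No definitions, no named facts. [Honest framing: generic complexity-class bookkeeping; nothing here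
bears on `VP ≠ VNP`.]

## References
* S. Arora, B. Barak, *Computational Complexity: A Modern Approach*, CUP 2009 (bib key
  `AroraBarakCC2009`): Thm. 2.8 (`≤ₚ` is transitive — downward closure of classes under `≤ₚ`),
  Def. 5.3 (the `∃`/`∀` operator pattern), §7.1 Def. 7.2 (`BPP`), §7.6 Def. 7.16 (randomized
  reductions, `BP·NP`), Thm. 8.18 (proof: every `coNP` language reduces to the complement of an
  NP-complete language).
-/

namespace Literature.Computability.Complexity

open _root_.Computability Polynomial
open scoped Notation
open Brick (fstF fstF_boolPair fstF_mem_FP)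

/-- **`BPP` is closed under intersection with a `P` language (on the left)**: for `K ∈ P` and
`L ∈ BPP` with witness `L' ∈ P` and coin polynomial `p`, the witness `fst⁻¹ K ⊓ L' ∈ P` works with the
same coins — on `x ∈ K` the good-coin event is unchanged, on `x ∉ K` every coin string is correct.
[cite: AroraBarakCC2009, §7.1 (Def. 7.2) and §7.6 (Def. 7.16)] -/
theorem inter_mem_BPP_of_mem_P_left {K L : Language Bool} (hK : K ∈ Classes.P) (hL : L ∈ BPP) :
    K ⊓ L ∈ BPP := by
  obtain ⟨L', hL', p, hp⟩ := hL
  refine ⟨(fstF ⁻¹' K) ⊓ L', inter_mem_P (preimage_mem_P hK fstF_mem_FP) hL', p, fun x => ?_⟩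
  by_cases hx : x ∈ K
  · convert hp x using 2
    ext y
    change (fstF (boolPair x y) ∈ K ∧ boolPair x y ∈ L' ↔ x ∈ K ∧ x ∈ L) ↔ (boolPair x y ∈ L' ↔ x ∈ L)
    simp only [fstF_boolPair, hx, true_and]
  · have h1 : (2 : ℝ) / 3 ≤ uniformProb (p.eval x.length) (Set.univ : Set (List Bool)) := by
      rw [uniformProb_univ]
      norm_num
    convert h1 using 2
    ext y
    change (fstF (boolPair x y) ∈ K ∧ boolPair x y ∈ L' ↔ x ∈ K ∧ x ∈ L) ↔ y ∈ Set.univ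
    simp only [fstF_boolPair, hx, false_and, Set.mem_univ]

/-- **`∃·BPP` is closed under polynomial-time preimages** (`preimage_mem_polyExists` with `K = BPP`:
`BPP` is closed under `FP` preimages and under intersection with `P` languages).
[cite: AroraBarakCC2009, Thm. 2.8 and §7.6 (Def. 7.16)] -/
theorem preimage_mem_polyExists_BPP {L : Language Bool} (hL : L ∈ polyExists BPP)
    {f : List Bool → List Bool} (hf : f ∈ FP) : f ⁻¹' L ∈ polyExists BPP :=
  preimage_mem_polyExists (fun _ hL _ hg => preimage_mem_BPP hL hg)
    (fun _ _ h₁ h₂ => inter_mem_BPP_of_mem_P_left h₁ h₂) hL hf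

/-- **`∃·BPP` is closed downward under Karp reductions**: `L₁ ≤ₚ L₂ ∈ ∃·BPP ⇒ L₁ ∈ ∃·BPP`.
[cite: AroraBarakCC2009, Thm. 2.8 and §7.6 (Def. 7.16)] -/
theorem mem_polyExists_BPP_of_karpReducible {L₁ L₂ : Language Bool} (h : L₁ ≤ₚ L₂)
    (h₂ : L₂ ∈ polyExists BPP) : L₁ ∈ polyExists BPP := by
  obtain ⟨f, hf, hfL⟩ := h
  rw [show L₁ = f ⁻¹' L₂ from Set.ext hfL]
  exact preimage_mem_polyExists_BPP h₂ hf

/-- `NP = ∃·P ⊆ ∃·BPP` (monotonicity of `∃·` and `P ⊆ BPP`). [cite: AroraBarakCC2009, Def. 5.3 and §7.1] -/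
theorem NP_subset_polyExists_BPP : Nondeterministic.NP ⊆ polyExists BPP :=
  polyExists_mono P_subset_BPP_holds

/-- **`coNP ⊆ ∃·BPP` from one NP-hard language whose complement is in `∃·BPP`**: every `coNP`
language Karp-reduces to `Lᶜ` (`IsNPHard.compl_isHard_coNP`), and `∃·BPP` is downward closed. This is
the class-level step of the "unless `coNP ⊆ ∃BPP`" barriers (BIJL18 Thm 4, BILPS19 Thm 40 / Cor 42).
[cite: AroraBarakCC2009, Thm. 8.18 (proof) and Thm. 2.8] -/
theorem coNP_subset_polyExists_BPP_of_isNPHard_of_compl_mem {L : Language Bool} (h : IsNPHard L)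
    (hL : Lᶜ ∈ polyExists BPP) : coNP ⊆ polyExists BPP :=
  fun L' hL' => mem_polyExists_BPP_of_karpReducible (IsNPHard.compl_isHard_coNP h L' hL') hL

/-- **`coNP ⊆ ∃·BPP ↔ Lᶜ ∈ ∃·BPP` for every NP-complete `L`.**
[cite: AroraBarakCC2009, Thm. 8.18 (proof) and Thm. 2.8] -/
theorem coNP_subset_polyExists_BPP_iff_compl_mem {L : Language Bool} (h : IsNPComplete L) :
    coNP ⊆ polyExists BPP ↔ Lᶜ ∈ polyExists BPP :=
  ⟨fun hsub => hsub (compl_mem_coNP_iff.2 h.mem),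
    coNP_subset_polyExists_BPP_of_isNPHard_of_compl_mem h.isHard⟩

end Literature.Computability.Complexity
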